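import Summits.ValiantsHypothesis.ValiantsHypothesis.Theorems.LacunarySymmetroidMatrixDescartesCensusTropicalKLawSlopes

/-!
# Route `KPlusLogSqLaw`, crux `TropicalB` — column split of a design, I: GLUING and SPLITTING Leibniz terms

HONEST FRAMING.  Helper file toward the registered stubs `stub_tropThin` / `stub_tropFat` of
`Cruxes/TropicalB/Lines/birth.lean` (crux `Summit.ValiantsHypothesis.ValiantsHypothesis.Theses.KPlusLogSqLaw.TropicalB`,
ledger item `stmt-ValiantsHypothesis-19771`, route `KPlusLogSqLaw`, DRAFT; cell `pub-symmetroid`, seat `val-sym-trop-p1`,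
2026-08-26).  Nothing here proves any part of a stub; nothing asserts `TropicalB`, `KPlusLogSqLaw`, `MatrixDescartes`
or anything about `VP ≠ VNP`.

This is the term-level bookkeeping of a Gusfield-type COLUMN SPLIT of a tropical design of format `c + e`: the columns
are the two blocks `Fin.castAdd e : Fin c → Fin (c+e)` and `Fin.natAdd c : Fin e → Fin (c+e)`, and two row embeddings
`r₁ : Fin c → Fin (c+e)`, `r₂ : Fin e → Fin (c+e)` (injective, with disjoint ranges — in the application the increasing
enumerations of a row set `R` and of its complement) define the two RESTRICTED designs
`v₁ i j l = v (r₁ i) (castAdd e j) l`, `ε₁ …` (format `c`) and `v₂ i j l = v (r₂ i) (natAdd c j) l`, `ε₂ …` (format `e`),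
with the same exponent vector `d`.  A full Leibniz term `q` is GLUED from a pair `(A, B)` of restricted terms when its
permutation and class map restrict to them block by block (the four equations `hq₁ … hq₄` below; no new definition is
introduced — every lemma takes the equations as hypotheses).  Proved, all [folklore]:

* `termSign_ne_zero_iff`            — a term is present iff all its entries are present;
* `tropWeight_of_glue`              — the weight of a glued term is the sum of the weights of its halves;
* `termSign_ne_zero_of_glue_iff`    — a glued term is present iff both halves are;
* `exists_glue`                     — every pair `(A, B)` glues to some full term (`Equiv.ofBijective` on `Fin.addCases`);
* `eq_of_glue_of_glue`, `halves_eq_of_glue` — gluing is a bijection between pairs and the terms it reaches;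
* `exists_halves`                   — a full term whose first-block rows lie in `range r₁` and second-block rows in
  `range r₂` is glued from some pair;
* `isDominant_halves_of_glue`       — **dominance restricts**: if a glued term is the unique optimum of the full design
  at slope `θ`, its halves are the unique optima of the restricted designs at `θ` (glue a competitor half with the other
  half of the optimum).
-/

set_option linter.dupNamespace false
set_option autoImplicit false

namespace Summit.ValiantsHypothesis.ValiantsHypothesis.Theorems.KPlusLogSqLaw

open Summit.ValiantsHypothesis.ValiantsHypothesis.Theorems.MatrixDescartes.Negative
open Summit.ValiantsHypothesis.ValiantsHypothesis.Theorems.LacunarySymmetroidMatrixDescartes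
open Summit.ValiantsHypothesis.ValiantsHypothesis.Theorems.LacunarySymmetroidMatrixDescartes.TropicalCensus
open scoped BigOperators
open Finset

section Present

variable {m K : ℕ}

/-- A Leibniz term is present (`termSign ≠ 0`) iff every entry it uses carries its class. [folklore] -/
theorem termSign_ne_zero_iff (ε : Fin m → Fin m → Fin K → ℤ) (q : Equiv.Perm (Fin m) × (Fin m → Fin K)) :
    termSign ε q ≠ 0 ↔ ∀ i, ε (q.1 i) i (q.2 i) ≠ 0 := by
  unfold termSign
  rw [mul_ne_zero_iff, prod_ne_zero_iff]
  constructor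
  · exact fun h i => h.2 i (mem_univ i)
  · intro h
    refine ⟨?_, fun i _ => h i⟩
    exact_mod_cast (Equiv.Perm.sign q.1).ne_zero

end Present

section Glue

variable {c e K : ℕ} (d : Fin K → ℕ) (v ε : Fin (c + e) → Fin (c + e) → Fin K → ℤ)
  (r₁ : Fin c → Fin (c + e)) (r₂ : Fin e → Fin (c + e))
  (v₁ ε₁ : Fin c → Fin c → Fin K → ℤ) (v₂ ε₂ : Fin e → Fin e → Fin K → ℤ)

/-- **Weight of a glued term** = weight of its first half in the first restricted design + weight of its second half in
the second restricted design. [folklore] -/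
theorem tropWeight_of_glue (hv₁ : ∀ i j l, v₁ i j l = v (r₁ i) (Fin.castAdd e j) l)
    (hv₂ : ∀ i j l, v₂ i j l = v (r₂ i) (Fin.natAdd c j) l)
    (q : Equiv.Perm (Fin (c + e)) × (Fin (c + e) → Fin K))
    (A : Equiv.Perm (Fin c) × (Fin c → Fin K)) (B : Equiv.Perm (Fin e) × (Fin e → Fin K))
    (hq₁ : ∀ j, q.1 (Fin.castAdd e j) = r₁ (A.1 j)) (hq₂ : ∀ j, q.1 (Fin.natAdd c j) = r₂ (B.1 j))
    (hq₃ : ∀ j, q.2 (Fin.castAdd e j) = A.2 j) (hq₄ : ∀ j, q.2 (Fin.natAdd c j) = B.2 j) (θ : ℤ) :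
    tropWeight d v θ q = tropWeight d v₁ θ A + tropWeight d v₂ θ B := by
  unfold tropWeight
  rw [Fin.sum_univ_add, Fin.sum_univ_add (fun i => v (q.1 i) i (q.2 i))]
  have e1 : ∑ j : Fin c, (d (q.2 (Fin.castAdd e j)) : ℤ) = ∑ j, (d (A.2 j) : ℤ) :=
    sum_congr rfl fun j _ => by rw [hq₃]
  have e2 : ∑ j : Fin e, (d (q.2 (Fin.natAdd c j)) : ℤ) = ∑ j, (d (B.2 j) : ℤ) :=
    sum_congr rfl fun j _ => by rw [hq₄]
  have e3 : ∑ j : Fin c, v (q.1 (Fin.castAdd e j)) (Fin.castAdd e j) (q.2 (Fin.castAdd e j)) =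
      ∑ j, v₁ (A.1 j) j (A.2 j) := sum_congr rfl fun j _ => by rw [hq₁, hq₃, hv₁]
  have e4 : ∑ j : Fin e, v (q.1 (Fin.natAdd c j)) (Fin.natAdd c j) (q.2 (Fin.natAdd c j)) =
      ∑ j, v₂ (B.1 j) j (B.2 j) := sum_congr rfl fun j _ => by rw [hq₂, hq₄, hv₂]
  rw [e1, e2, e3, e4]
  ring

/-- **A glued term is present iff both halves are present.** [folklore] -/
theorem termSign_ne_zero_of_glue_iff (hε₁ : ∀ i j l, ε₁ i j l = ε (r₁ i) (Fin.castAdd e j) l)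
    (hε₂ : ∀ i j l, ε₂ i j l = ε (r₂ i) (Fin.natAdd c j) l)
    (q : Equiv.Perm (Fin (c + e)) × (Fin (c + e) → Fin K))
    (A : Equiv.Perm (Fin c) × (Fin c → Fin K)) (B : Equiv.Perm (Fin e) × (Fin e → Fin K))
    (hq₁ : ∀ j, q.1 (Fin.castAdd e j) = r₁ (A.1 j)) (hq₂ : ∀ j, q.1 (Fin.natAdd c j) = r₂ (B.1 j))
    (hq₃ : ∀ j, q.2 (Fin.castAdd e j) = A.2 j) (hq₄ : ∀ j, q.2 (Fin.natAdd c j) = B.2 j) :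
    termSign ε q ≠ 0 ↔ termSign ε₁ A ≠ 0 ∧ termSign ε₂ B ≠ 0 := by
  rw [termSign_ne_zero_iff, termSign_ne_zero_iff, termSign_ne_zero_iff]
  constructor
  · intro h
    refine ⟨fun j => ?_, fun j => ?_⟩
    · rw [hε₁, ← hq₁, ← hq₃]; exact h _
    · rw [hε₂, ← hq₂, ← hq₄]; exact h _
  · rintro ⟨hA, hB⟩ i
    refine Fin.addCases (fun j => ?_) (fun j => ?_) i
    · rw [hq₁, hq₃, ← hε₁]; exact hA j
    · rw [hq₂, hq₄, ← hε₂]; exact hB j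

/-- **Every pair of restricted terms glues to a full term** (the glued permutation is `Fin.addCases (r₁ ∘ A.1) (r₂ ∘ B.1)`,
a bijection because the two row embeddings are injective with disjoint ranges). [folklore] -/
theorem exists_glue (hr₁ : Function.Injective r₁) (hr₂ : Function.Injective r₂) (hdisj : ∀ i j, r₁ i ≠ r₂ j)
    (A : Equiv.Perm (Fin c) × (Fin c → Fin K)) (B : Equiv.Perm (Fin e) × (Fin e → Fin K)) :
    ∃ q : Equiv.Perm (Fin (c + e)) × (Fin (c + e) → Fin K),
      (∀ j, q.1 (Fin.castAdd e j) = r₁ (A.1 j)) ∧ (∀ j, q.1 (Fin.natAdd c j) = r₂ (B.1 j)) ∧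
      (∀ j, q.2 (Fin.castAdd e j) = A.2 j) ∧ (∀ j, q.2 (Fin.natAdd c j) = B.2 j) := by
  set f : Fin (c + e) → Fin (c + e) := Fin.addCases (fun j => r₁ (A.1 j)) (fun j => r₂ (B.1 j)) with hf
  have hfl : ∀ j, f (Fin.castAdd e j) = r₁ (A.1 j) := fun j => by simp [hf]
  have hfr : ∀ j, f (Fin.natAdd c j) = r₂ (B.1 j) := fun j => by simp [hf]
  have hinj : Function.Injective f := by
    intro x y hxy
    induction x using Fin.addCases with
    | left jx =>
      induction y using Fin.addCases with
      | left jy =>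
        rw [hfl, hfl] at hxy
        rw [A.1.injective (hr₁ hxy)]
      | right jy =>
        rw [hfl, hfr] at hxy
        exact absurd hxy (hdisj _ _)
    | right jx =>
      induction y using Fin.addCases with
      | left jy =>
        rw [hfr, hfl] at hxy
        exact absurd hxy.symm (hdisj _ _)
      | right jy =>
        rw [hfr, hfr] at hxy
        rw [B.1.injective (hr₂ hxy)]
  have hbij : Function.Bijective f := Finite.injective_iff_bijective.mp hinj
  refine ⟨(Equiv.ofBijective f hbij, Fin.addCases A.2 B.2), fun j => ?_, fun j => ?_, fun j => ?_, fun j => ?_⟩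
  · exact hfl j
  · exact hfr j
  · simp
  · simp

/-- Two full terms glued from the same pair are equal. [folklore] -/
theorem eq_of_glue_of_glue (q q' : Equiv.Perm (Fin (c + e)) × (Fin (c + e) → Fin K))
    (A : Equiv.Perm (Fin c) × (Fin c → Fin K)) (B : Equiv.Perm (Fin e) × (Fin e → Fin K))
    (hq₁ : ∀ j, q.1 (Fin.castAdd e j) = r₁ (A.1 j)) (hq₂ : ∀ j, q.1 (Fin.natAdd c j) = r₂ (B.1 j))
    (hq₃ : ∀ j, q.2 (Fin.castAdd e j) = A.2 j) (hq₄ : ∀ j, q.2 (Fin.natAdd c j) = B.2 j)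
    (hq'₁ : ∀ j, q'.1 (Fin.castAdd e j) = r₁ (A.1 j)) (hq'₂ : ∀ j, q'.1 (Fin.natAdd c j) = r₂ (B.1 j))
    (hq'₃ : ∀ j, q'.2 (Fin.castAdd e j) = A.2 j) (hq'₄ : ∀ j, q'.2 (Fin.natAdd c j) = B.2 j) : q = q' := by
  refine Prod.ext (Equiv.ext fun x => ?_) (funext fun x => ?_)
  · refine Fin.addCases (fun j => ?_) (fun j => ?_) x
    · rw [hq₁, hq'₁]
    · rw [hq₂, hq'₂]
  · refine Fin.addCases (fun j => ?_) (fun j => ?_) x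
    · rw [hq₃, hq'₃]
    · rw [hq₄, hq'₄]

/-- A full term glued from `(A, B)` and from `(A', B')` forces `A = A'` and `B = B'` (the row embeddings are
injective). [folklore] -/
theorem halves_eq_of_glue (hr₁ : Function.Injective r₁) (hr₂ : Function.Injective r₂)
    (q : Equiv.Perm (Fin (c + e)) × (Fin (c + e) → Fin K))
    (A A' : Equiv.Perm (Fin c) × (Fin c → Fin K)) (B B' : Equiv.Perm (Fin e) × (Fin e → Fin K))
    (hq₁ : ∀ j, q.1 (Fin.castAdd e j) = r₁ (A.1 j)) (hq₂ : ∀ j, q.1 (Fin.natAdd c j) = r₂ (B.1 j))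
    (hq₃ : ∀ j, q.2 (Fin.castAdd e j) = A.2 j) (hq₄ : ∀ j, q.2 (Fin.natAdd c j) = B.2 j)
    (hq'₁ : ∀ j, q.1 (Fin.castAdd e j) = r₁ (A'.1 j)) (hq'₂ : ∀ j, q.1 (Fin.natAdd c j) = r₂ (B'.1 j))
    (hq'₃ : ∀ j, q.2 (Fin.castAdd e j) = A'.2 j) (hq'₄ : ∀ j, q.2 (Fin.natAdd c j) = B'.2 j) :
    A = A' ∧ B = B' := by
  refine ⟨Prod.ext (Equiv.ext fun j => hr₁ ?_) (funext fun j => ?_),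
    Prod.ext (Equiv.ext fun j => hr₂ ?_) (funext fun j => ?_)⟩
  · rw [← hq₁, hq'₁]
  · rw [← hq₃, hq'₃]
  · rw [← hq₂, hq'₂]
  · rw [← hq₄, hq'₄]

/-- **Splitting.**  A full term whose first-block rows lie in the range of `r₁` and whose second-block rows lie in the
range of `r₂` is glued from a pair of restricted terms. [folklore] -/
theorem exists_halves (q : Equiv.Perm (Fin (c + e)) × (Fin (c + e) → Fin K))
    (hran₁ : ∀ j, ∃ i, r₁ i = q.1 (Fin.castAdd e j)) (hran₂ : ∀ j, ∃ i, r₂ i = q.1 (Fin.natAdd c j)) :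
    ∃ (A : Equiv.Perm (Fin c) × (Fin c → Fin K)) (B : Equiv.Perm (Fin e) × (Fin e → Fin K)),
      (∀ j, q.1 (Fin.castAdd e j) = r₁ (A.1 j)) ∧ (∀ j, q.1 (Fin.natAdd c j) = r₂ (B.1 j)) ∧
      (∀ j, q.2 (Fin.castAdd e j) = A.2 j) ∧ (∀ j, q.2 (Fin.natAdd c j) = B.2 j) := by
  choose f hf using hran₁
  choose g hg using hran₂
  have hfinj : Function.Injective f := by
    intro j j' h
    have := hf j
    rw [h, hf j'] at this
    exact Fin.castAdd_injective _ _ (q.1.injective this.symm)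
  have hginj : Function.Injective g := by
    intro j j' h
    have := hg j
    rw [h, hg j'] at this
    exact Fin.natAdd_injective _ _ (q.1.injective this.symm)
  refine ⟨(Equiv.ofBijective f (Finite.injective_iff_bijective.mp hfinj), fun j => q.2 (Fin.castAdd e j)),
    (Equiv.ofBijective g (Finite.injective_iff_bijective.mp hginj), fun j => q.2 (Fin.natAdd c j)),
    fun j => ?_, fun j => ?_, fun j => rfl, fun j => rfl⟩
  · simp [hf]
  · simp [hg]

/-- **Dominance restricts to the halves.**  If a term glued from `(A, B)` is the unique optimum of the full design at
slope `θ`, then `A` is the unique optimum of the first restricted design at `θ` and `B` of the second: a competitor of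
`A` glued with `B` (resp. `A` glued with a competitor of `B`) is a present full term, different from the optimum, whose
weight differs from the optimum's by the same amount. [folklore] -/
theorem isDominant_halves_of_glue (hr₁ : Function.Injective r₁) (hr₂ : Function.Injective r₂)
    (hdisj : ∀ i j, r₁ i ≠ r₂ j)
    (hv₁ : ∀ i j l, v₁ i j l = v (r₁ i) (Fin.castAdd e j) l) (hε₁ : ∀ i j l, ε₁ i j l = ε (r₁ i) (Fin.castAdd e j) l)
    (hv₂ : ∀ i j l, v₂ i j l = v (r₂ i) (Fin.natAdd c j) l) (hε₂ : ∀ i j l, ε₂ i j l = ε (r₂ i) (Fin.natAdd c j) l)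
    (q : Equiv.Perm (Fin (c + e)) × (Fin (c + e) → Fin K))
    (A : Equiv.Perm (Fin c) × (Fin c → Fin K)) (B : Equiv.Perm (Fin e) × (Fin e → Fin K))
    (hq₁ : ∀ j, q.1 (Fin.castAdd e j) = r₁ (A.1 j)) (hq₂ : ∀ j, q.1 (Fin.natAdd c j) = r₂ (B.1 j))
    (hq₃ : ∀ j, q.2 (Fin.castAdd e j) = A.2 j) (hq₄ : ∀ j, q.2 (Fin.natAdd c j) = B.2 j)
    {θ : ℤ} (hdom : IsDominant d v ε θ q) :
    IsDominant d v₁ ε₁ θ A ∧ IsDominant d v₂ ε₂ θ B := by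
  have hpres := (termSign_ne_zero_of_glue_iff ε r₁ r₂ ε₁ ε₂ hε₁ hε₂ q A B hq₁ hq₂ hq₃ hq₄).mp hdom.1
  have hwq := tropWeight_of_glue d v r₁ r₂ v₁ v₂ hv₁ hv₂ q A B hq₁ hq₂ hq₃ hq₄ θ
  refine ⟨⟨hpres.1, fun A' hA' hA's => ?_⟩, ⟨hpres.2, fun B' hB' hB's => ?_⟩⟩
  · obtain ⟨q', hq'₁, hq'₂, hq'₃, hq'₄⟩ := exists_glue r₁ r₂ hr₁ hr₂ hdisj A' B
    have hq's : termSign ε q' ≠ 0 :=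
      (termSign_ne_zero_of_glue_iff ε r₁ r₂ ε₁ ε₂ hε₁ hε₂ q' A' B hq'₁ hq'₂ hq'₃ hq'₄).mpr ⟨hA's, hpres.2⟩
    have hne : q' ≠ q := by
      intro h
      subst h
      exact hA' (halves_eq_of_glue r₁ r₂ hr₁ hr₂ q' A' A B B hq'₁ hq'₂ hq'₃ hq'₄ hq₁ hq₂ hq₃ hq₄).1
    have hlt := hdom.2 q' hne hq's
    rw [hwq, tropWeight_of_glue d v r₁ r₂ v₁ v₂ hv₁ hv₂ q' A' B hq'₁ hq'₂ hq'₃ hq'₄ θ] at hlt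
    linarith
  · obtain ⟨q', hq'₁, hq'₂, hq'₃, hq'₄⟩ := exists_glue r₁ r₂ hr₁ hr₂ hdisj A B'
    have hq's : termSign ε q' ≠ 0 :=
      (termSign_ne_zero_of_glue_iff ε r₁ r₂ ε₁ ε₂ hε₁ hε₂ q' A B' hq'₁ hq'₂ hq'₃ hq'₄).mpr ⟨hpres.1, hB's⟩
    have hne : q' ≠ q := by
      intro h
      subst h
      exact hB' (halves_eq_of_glue r₁ r₂ hr₁ hr₂ q' A A B' B hq'₁ hq'₂ hq'₃ hq'₄ hq₁ hq₂ hq₃ hq₄).2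
    have hlt := hdom.2 q' hne hq's
    rw [hwq, tropWeight_of_glue d v r₁ r₂ v₁ v₂ hv₁ hv₂ q' A B' hq'₁ hq'₂ hq'₃ hq'₄ θ] at hlt
    linarith

end Glue

end Summit.ValiantsHypothesis.ValiantsHypothesis.Theorems.KPlusLogSqLaw
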